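import Summits.CriticalPhenomena.SAWScalingLimit.Theorems.SAWMassiveIsingTiltDefs
import Summits.CriticalPhenomena.SAWScalingLimit.Theorems.SAWMassiveIsingTiltMassiveWindowSLEStubIsingTwoPointLocality
import Summits.CriticalPhenomena.SAWScalingLimit.Theorems.SAWMassiveIsingTiltMassiveWindowSLEStubZloopEdgeCalculus
import Summits.CriticalPhenomena.SAWScalingLimit.Theorems.SAWMassiveIsingTiltMassiveWindowSLEStubZloopMixingEdgeBound
import HarnessLib

/-!
# Crux `MassiveWindowSLE` (stmt-CriticalPhenomena-7685), line `registered`: the loop-`O(1)` bath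
# factor is LOG-SUPERMODULAR — the massive Ising bath mediates an ATTRACTION between the pieces of
# the tilted interface

Route `SAWMassiveIsingTilt` of `CriticalPhenomena/SAWScalingLimit`. The tilted interface law of the
route weights a hexagonal self-avoiding path `γ` by `x^{|V(γ)|} · Zloop(Ω_δ ∖ V(γ); y)`: the second
factor is the partition function of the high-temperature (loop `O(1)`) Ising bath on the complement of
the walk. This file proves the one rigorous qualitative fact about that factor used in the lead-c5
analysis of the open stub S1' (`Cruxes/MassiveWindowSLE/PROMOTE-r11.md`, §(ii).2):

* `zloop_mul_zloop_le_inter_mul_union` — for a finite subgraph `H ≤ hexGraph`, `0 ≤ β`, and any two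
  vertex sets, `Zloop H S₁ (tanh β) · Zloop H S₂ (tanh β) ≤ Zloop H (S₁ ∩ S₂) (tanh β) · Zloop H (S₁ ∪ S₂) (tanh β)`:
  `S ↦ log Zloop(H, S; y)` is supermodular;
* `zloop_bath_attraction` — consequently the bath weight `w(A) = Zloop(H ∖ A)/Zloop(H)` of a removed
  vertex set is log-supermodular, `w(A ∪ B) · w(∅) ≥ w(A) · w(B)` (stated multiplied out, for the
  complements `S_j = A_jᶜ`): removing two tubes together is cheaper than removing them separately — a
  depletion ATTRACTION between non-overlapping pieces of the walk, of the range of the bath's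
  correlation length.

Proof. Pass to loop sums `L(X) = Zloop (fromEdgeSet X) univ` over finite EDGE sets `X` of the
honeycomb lattice (`zloop_eq_zloopE`). Adding one edge `e = {u,v}`:
`L(X + e) = L(X) + y · W_X(u,v)` (`alg_zloop_add_edge`, landed stub Malg), and
`W_X(u,v)/L(X) = ⟨σ_uσ_v⟩^free` of the Ising model on the graph `fromEdgeSet X` at `tanh β = y`
(high-temperature expansion `isingCorr_free_eq_hteSum_div`, bridge `itl_finsum_pair_eq_hteSum`), which
is nondecreasing in `X` by the second Griffiths inequality (`isingCorr_free_mono_graph` fed with the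
tree's PROVED `GKSInequalities.gks_two_holds`). Hence `X ↦ log L(X)` has increasing differences
(`ba_add_edge_incrDiff`), hence is supermodular (`zloopE_superMod`, induction on `#(X ∖ Y)`);
monotonicity of `L` in `X` and `E(H[S₁]) ∩ E(H[S₂]) = E(H[S₁ ∩ S₂])`,
`E(H[S₁]) ∪ E(H[S₂]) ⊆ E(H[S₁ ∪ S₂])` give the vertex-set form.

References: R. B. Griffiths, J. Math. Phys. 8 (1967) 478, 484; D. G. Kelly, S. Sherman, J. Math.
Phys. 9 (1968) 466 (GKS II); S. Friedli, Y. Velenik, *Statistical Mechanics of Lattice Systems*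
(CUP 2017), Thm. 3.20 and Exercise 3.31 (monotonicity in the couplings); H. Duminil-Copin, lectures on
the Ising and Potts models (2017), §2.2.1 (high-temperature expansion).
-/

noncomputable section

open scoped BigOperators Classical
open Set
open Literature.Probability Literature.Probability.LatticeModels
open Summit.CriticalPhenomena.SAWScalingLimit.Theorems.SAWMassiveIsingTilt (Zloop)

namespace Summit.CriticalPhenomena.SAWScalingLimit.Theorems.MassiveWindowSLE.Birth

/-! ### Loop sums over finite edge sets of the honeycomb lattice -/

/-- The edge set of `(SimpleGraph.fromEdgeSet (↑X : Set (Sym2 HexVertex)))` is `X` when `X` consists of honeycomb edges (no diagonals). -/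
theorem ba_edgeSet_graphE {X : Finset (Sym2 HexVertex)} (hX : (↑X : Set (Sym2 HexVertex)) ⊆ hexGraph.edgeSet) :
    ((SimpleGraph.fromEdgeSet (↑X : Set (Sym2 HexVertex)))).edgeSet = ↑X := by
  ext e
  rw [SimpleGraph.edgeSet_fromEdgeSet, Set.mem_sdiff]
  exact ⟨fun h => h.1, fun h => ⟨h, fun hd =>
    SimpleGraph.not_isDiag_of_mem_edgeSet _ (hX h) (Sym2.mem_diagSet.1 hd)⟩⟩

/-- A graph spanned by honeycomb edges is a subgraph of `hexGraph`. -/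
theorem ba_graphE_le {X : Finset (Sym2 HexVertex)} (hX : (↑X : Set (Sym2 HexVertex)) ⊆ hexGraph.edgeSet) :
    (SimpleGraph.fromEdgeSet (↑X : Set (Sym2 HexVertex))) ≤ hexGraph := by
  calc (SimpleGraph.fromEdgeSet (↑X : Set (Sym2 HexVertex))) ≤ SimpleGraph.fromEdgeSet hexGraph.edgeSet := SimpleGraph.fromEdgeSet_mono hX
    _ = hexGraph := SimpleGraph.fromEdgeSet_edgeSet _

/-- A graph spanned by a finite edge set has finitely many edges. -/
theorem ba_finite_graphE (X : Finset (Sym2 HexVertex)) : ((SimpleGraph.fromEdgeSet (↑X : Set (Sym2 HexVertex)))).edgeSet.Finite := by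
  rw [SimpleGraph.edgeSet_fromEdgeSet]
  exact X.finite_toSet.subset Set.sdiff_subset

/-- `Zloop ≥ 1` for a graph with finitely many edges and `y ≥ 0` (the empty edge set contributes `1`). -/
theorem ba_one_le_zloop {H : SimpleGraph HexVertex} {S : Set HexVertex} (hfin : H.edgeSet.Finite)
    {y : ℝ} (hy : 0 ≤ y) : 1 ≤ Zloop H S y :=
  mix_one_le_zloop (hfin.subset fun _ he => he.1) hy

/-! ### The bridge with an explicit volume, and GKS monotonicity of the loop two-point ratio -/

/-- **Bridge with a prescribed volume.** If the finite set `Λ ⊆ S` contains every endpoint of every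
edge of `H` inside `S`, then `W_{H,S}(u,v; t) = hteSum H Λ t {u,v}` and `Zloop H S t = hteSum H Λ t ∅`. -/
theorem ba_loop_eq_hteSum {H : SimpleGraph HexVertex} [H.LocallyFinite] {S : Set HexVertex}
    {Λ : Finset HexVertex} (hΛS : (↑Λ : Set HexVertex) ⊆ S)
    (hend : ∀ e ∈ H.edgeSet, (∀ w ∈ e, w ∈ S) → ∀ w ∈ e, w ∈ Λ) (t : ℝ) (u v : HexVertex) :
    (∑ᶠ E ∈ {E : Finset (Sym2 HexVertex) | (∀ e ∈ E, e ∈ H.edgeSet ∧ ∀ w ∈ e, w ∈ S) ∧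
      ∀ w : HexVertex, (Odd (E.filter (fun e => w ∈ e)).card ↔ (w = u ∨ w = v))}, t ^ E.card) = hteSum H Λ t {u, v} ∧ Zloop H S t = hteSum H Λ t ∅ := by
  have hedge : ∀ e : Sym2 HexVertex, (e ∈ H.edgeSet ∧ ∀ w ∈ e, w ∈ S) ↔
      (e ∈ H.edgeSet ∧ ∀ w ∈ e, w ∈ (↑Λ : Set HexVertex)) := fun e =>
    ⟨fun h => ⟨h.1, hend e h.1 h.2⟩, fun h => ⟨h.1, fun w hw => hΛS (h.2 w hw)⟩⟩
  refine ⟨?_, ?_⟩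
  · rw [← itl_finsum_pair_eq_hteSum H Λ t u v]
    simp only [hedge]
  · unfold Zloop
    rw [← itl_finsum_even_eq_hteSum H Λ t]
    simp only [hedge]

/-- **GKS II in loop language.** For finite `H₁ ≤ H₂ ≤ hexGraph`, a vertex set `S ∋ u, v` and
`β ≥ 0`: `W_{H₁,S}(u,v)/Zloop(H₁,S) ≤ W_{H₂,S}(u,v)/Zloop(H₂,S)` at `t = tanh β` — the loop two-point
ratio is the free Ising correlation `⟨σ_uσ_v⟩` of the graph read inside `S`, nondecreasing in the graph. -/
theorem ba_loopRatio_mono {H₁ H₂ : SimpleGraph HexVertex} (h₂ : H₂ ≤ hexGraph) (hle : H₁ ≤ H₂)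
    (hfin₂ : H₂.edgeSet.Finite) (S : Set HexVertex) {u v : HexVertex} (hu : u ∈ S) (hv : v ∈ S)
    {β : ℝ} (hβ : 0 ≤ β) :
    (∑ᶠ E ∈ {E : Finset (Sym2 HexVertex) | (∀ e ∈ E, e ∈ H₁.edgeSet ∧ ∀ w ∈ e, w ∈ S) ∧
      ∀ w : HexVertex, (Odd (E.filter (fun e => w ∈ e)).card ↔ (w = u ∨ w = v))}, (Real.tanh β) ^ E.card) / Zloop H₁ S (Real.tanh β) ≤
      (∑ᶠ E ∈ {E : Finset (Sym2 HexVertex) | (∀ e ∈ E, e ∈ H₂.edgeSet ∧ ∀ w ∈ e, w ∈ S) ∧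
      ∀ w : HexVertex, (Odd (E.filter (fun e => w ∈ e)).card ↔ (w = u ∨ w = v))}, (Real.tanh β) ^ E.card) / Zloop H₂ S (Real.tanh β) := by
  obtain ⟨_⟩ := geo_nonempty_locallyFinite h₂
  obtain ⟨_⟩ := geo_nonempty_locallyFinite (hle.trans h₂)
  -- common volume: `u, v` and all endpoints of edges of `H₂` inside `S`
  set Λ : Finset HexVertex := {u, v} ∪ (hfin₂.toFinset.filter fun e => ∀ w ∈ e, w ∈ S).biUnion
    Sym2.toFinset with hΛ
  have hΛS : (↑Λ : Set HexVertex) ⊆ S := by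
    intro w hw
    rcases Finset.mem_union.1 (Finset.mem_coe.1 hw) with h | h
    · rcases Finset.mem_insert.1 h with rfl | h
      · exact hu
      · rw [Finset.mem_singleton] at h; subst h; exact hv
    · obtain ⟨e, he, hwe⟩ := Finset.mem_biUnion.1 h
      exact (Finset.mem_filter.1 he).2 w (Sym2.mem_toFinset.1 hwe)
  have hend₂ : ∀ e ∈ H₂.edgeSet, (∀ w ∈ e, w ∈ S) → ∀ w ∈ e, w ∈ Λ := fun e he hS w hw =>
    Finset.mem_union_right _ (Finset.mem_biUnion.2 ⟨e, Finset.mem_filter.2 ⟨hfin₂.mem_toFinset.2 he, hS⟩,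
      Sym2.mem_toFinset.2 hw⟩)
  have hend₁ : ∀ e ∈ H₁.edgeSet, (∀ w ∈ e, w ∈ S) → ∀ w ∈ e, w ∈ Λ := fun e he =>
    hend₂ e (SimpleGraph.edgeSet_mono hle he)
  have hA : ({u, v} : Finset HexVertex) ⊆ Λ := Finset.subset_union_left
  obtain ⟨hW₁, hZ₁⟩ := ba_loop_eq_hteSum (H := H₁) hΛS hend₁ (Real.tanh β) u v
  obtain ⟨hW₂, hZ₂⟩ := ba_loop_eq_hteSum (H := H₂) hΛS hend₂ (Real.tanh β) u v
  rw [hW₁, hZ₁, hW₂, hZ₂, ← isingCorr_free_eq_hteSum_div H₁ Λ β hA,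
    ← isingCorr_free_eq_hteSum_div H₂ Λ β hA]
  exact isingCorr_free_mono_graph (fun _ _ _ _ _ _ => GKSInequalities.gks_two_holds H₁) hle hβ le_rfl hA

/-! ### Increasing differences: adding one edge -/

/-- **Increasing differences.** For finite `H₁ ≤ H₂ ≤ hexGraph`, a new honeycomb edge `e = {u,v}`
(`¬ H₂.Adj u v`), `u, v ∈ S` and `t = tanh β`, `β ≥ 0`:
`Zloop(H₁ + e, S) · Zloop(H₂, S) ≤ Zloop(H₁, S) · Zloop(H₂ + e, S)`. -/
theorem ba_add_edge_incrDiff {H₁ H₂ : SimpleGraph HexVertex} (h₂ : H₂ ≤ hexGraph) (hle : H₁ ≤ H₂)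
    (hfin₂ : H₂.edgeSet.Finite) (S : Set HexVertex) {u v : HexVertex} (huv : u ≠ v)
    (hadj : ¬ H₂.Adj u v) (hu : u ∈ S) (hv : v ∈ S) {β : ℝ} (hβ : 0 ≤ β) :
    Zloop (H₁ ⊔ SimpleGraph.fromEdgeSet {s(u, v)}) S (Real.tanh β) * Zloop H₂ S (Real.tanh β) ≤
      Zloop H₁ S (Real.tanh β) * Zloop (H₂ ⊔ SimpleGraph.fromEdgeSet {s(u, v)}) S (Real.tanh β) := by
  have hfin₁ : H₁.edgeSet.Finite := hfin₂.subset (SimpleGraph.edgeSet_mono hle)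
  have hadj₁ : ¬ H₁.Adj u v := fun h => hadj (hle h)
  have ht : 0 ≤ Real.tanh β := by
    rw [Real.tanh_eq_sinh_div_cosh]
    exact div_nonneg (Real.sinh_nonneg_iff.2 hβ) (Real.cosh_pos β).le
  rw [alg_zloop_add_edge H₁ S (Real.tanh β) u v hfin₁ huv hadj₁ hu hv,
    alg_zloop_add_edge H₂ S (Real.tanh β) u v hfin₂ huv hadj hu hv]
  have hZ₁ : 1 ≤ Zloop H₁ S (Real.tanh β) := ba_one_le_zloop hfin₁ ht
  have hZ₂ : 1 ≤ Zloop H₂ S (Real.tanh β) := ba_one_le_zloop hfin₂ ht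
  have hmono := ba_loopRatio_mono h₂ hle hfin₂ S hu hv hβ
  rw [div_le_div_iff₀ (by linarith) (by linarith)] at hmono
  nlinarith [mul_le_mul_of_nonneg_left hmono ht]

/-! ### Supermodularity over edge sets -/

/-- Inserting an edge into the spanning set adds that edge to the graph: `G(X + e) = G(X) ⊔ {e}`. -/
theorem ba_graphE_insert (X : Finset (Sym2 HexVertex)) (e : Sym2 HexVertex) :
    (SimpleGraph.fromEdgeSet (↑(insert e X) : Set (Sym2 HexVertex))) = (SimpleGraph.fromEdgeSet (↑X : Set (Sym2 HexVertex))) ⊔ SimpleGraph.fromEdgeSet {e} := by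
  rw [Finset.coe_insert, ← SimpleGraph.fromEdgeSet_union, Set.union_singleton]

/-- **`X ↦ log L(X)` is supermodular** on finite sets of honeycomb edges (`t = tanh β`, `β ≥ 0`):
`L(X) · L(Y) ≤ L(X ∩ Y) · L(X ∪ Y)`. Induction on `#(X ∖ Y)` from increasing differences. -/
theorem zloopE_superMod {β : ℝ} (hβ : 0 ≤ β) :
    ∀ (n : ℕ) (X Y : Finset (Sym2 HexVertex)), (X \ Y).card = n →
      (↑X : Set (Sym2 HexVertex)) ⊆ hexGraph.edgeSet → (↑Y : Set (Sym2 HexVertex)) ⊆ hexGraph.edgeSet →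
        Zloop (SimpleGraph.fromEdgeSet (↑X : Set (Sym2 HexVertex))) Set.univ (Real.tanh β) * Zloop (SimpleGraph.fromEdgeSet (↑Y : Set (Sym2 HexVertex))) Set.univ (Real.tanh β) ≤
          Zloop (SimpleGraph.fromEdgeSet (↑(X ∩ Y) : Set (Sym2 HexVertex))) Set.univ (Real.tanh β) * Zloop (SimpleGraph.fromEdgeSet (↑(X ∪ Y) : Set (Sym2 HexVertex))) Set.univ (Real.tanh β) := by
  have ht : 0 ≤ Real.tanh β := by
    rw [Real.tanh_eq_sinh_div_cosh]
    exact div_nonneg (Real.sinh_nonneg_iff.2 hβ) (Real.cosh_pos β).le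
  intro n
  induction n with
  | zero =>
    intro X Y hcard _ _
    have hXY : X ⊆ Y := Finset.sdiff_eq_empty_iff_subset.1 (Finset.card_eq_zero.1 hcard)
    rw [Finset.inter_eq_left.2 hXY, Finset.union_eq_right.2 hXY]
  | succ n ih =>
    intro X Y hcard hX hY
    obtain ⟨e, he⟩ : (X \ Y).Nonempty := Finset.card_pos.1 (by omega)
    have heX : e ∈ X := (Finset.mem_sdiff.1 he).1
    have heY : e ∉ Y := (Finset.mem_sdiff.1 he).2
    set X' := X.erase e with hX'
    have hXins : X = insert e X' := (Finset.insert_erase heX).symm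
    have hX'sub : (↑X' : Set (Sym2 HexVertex)) ⊆ hexGraph.edgeSet := fun f hf =>
      hX (Finset.mem_coe.2 (Finset.mem_of_mem_erase (Finset.mem_coe.1 hf)))
    have heX' : e ∉ X' := Finset.notMem_erase e X
    have hcard' : (X' \ Y).card = n := by
      have h1 : X' \ Y = (X \ Y).erase e := by
        ext f
        simp only [hX', Finset.mem_sdiff, Finset.mem_erase]
        tauto
      rw [h1, Finset.card_erase_of_mem he, hcard]
      rfl
    -- the induction hypothesis for `X'`
    have hIH := ih X' Y hcard' hX'sub hY
    -- increasing differences between `(SimpleGraph.fromEdgeSet (↑X' : Set (Sym2 HexVertex))) ≤ (SimpleGraph.fromEdgeSet (↑(X' ∪ Y) : Set (Sym2 HexVertex)))` for the edge `e`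
    have heE : e ∈ hexGraph.edgeSet := hX (Finset.mem_coe.2 heX)
    induction e using Sym2.ind with
    | h u v =>
      have huv : u ≠ v := fun h => SimpleGraph.not_isDiag_of_mem_edgeSet _ heE (Sym2.mk_isDiag_iff.2 h)
      have hXYsub : (↑(X' ∪ Y) : Set (Sym2 HexVertex)) ⊆ hexGraph.edgeSet := by
        rw [Finset.coe_union]; exact Set.union_subset hX'sub hY
      have hle : (SimpleGraph.fromEdgeSet (↑X' : Set (Sym2 HexVertex))) ≤ (SimpleGraph.fromEdgeSet (↑(X' ∪ Y) : Set (Sym2 HexVertex))) :=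
        SimpleGraph.fromEdgeSet_mono (by rw [Finset.coe_union]; exact Set.subset_union_left)
      have hadj : ¬ ((SimpleGraph.fromEdgeSet (↑(X' ∪ Y) : Set (Sym2 HexVertex)))).Adj u v := by
        rw [SimpleGraph.fromEdgeSet_adj]
        rintro ⟨h, -⟩
        rcases Finset.mem_union.1 (Finset.mem_coe.1 h) with h | h
        · exact heX' h
        · exact heY h
      have hID := ba_add_edge_incrDiff (ba_graphE_le hXYsub) hle (ba_finite_graphE _) Set.univ huv hadj
        (Set.mem_univ u) (Set.mem_univ v) hβ
      -- rewrite the graphs with the added edge as `graphE` of inserted finsets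
      have h1 : (SimpleGraph.fromEdgeSet (↑X' : Set (Sym2 HexVertex))) ⊔ SimpleGraph.fromEdgeSet {s(u, v)} = (SimpleGraph.fromEdgeSet (↑X : Set (Sym2 HexVertex))) := by
        rw [hXins, ba_graphE_insert]
      have h2 : (SimpleGraph.fromEdgeSet (↑(X' ∪ Y) : Set (Sym2 HexVertex))) ⊔ SimpleGraph.fromEdgeSet {s(u, v)} = (SimpleGraph.fromEdgeSet (↑(X ∪ Y) : Set (Sym2 HexVertex))) := by
        rw [← ba_graphE_insert, hXins, Finset.insert_union]
      rw [h1, h2] at hID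
      have h3 : X ∩ Y = X' ∩ Y := by
        rw [hXins, Finset.insert_inter_of_notMem heY]
      rw [h3]
      -- combine: hIH : L X' * L Y ≤ L (X'∩Y) * L (X'∪Y);  hID : L X * L (X'∪Y) ≤ L X' * L (X∪Y)
      have hpos₁ : 1 ≤ Zloop (SimpleGraph.fromEdgeSet (↑X' : Set (Sym2 HexVertex))) Set.univ (Real.tanh β) := ba_one_le_zloop (ba_finite_graphE _) ht
      have hpos₂ : 1 ≤ Zloop (SimpleGraph.fromEdgeSet (↑(X' ∪ Y) : Set (Sym2 HexVertex))) Set.univ (Real.tanh β) := ba_one_le_zloop (ba_finite_graphE _) ht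
      have hn₀ : 0 ≤ Zloop (SimpleGraph.fromEdgeSet (↑X : Set (Sym2 HexVertex))) Set.univ (Real.tanh β) := zero_le_one.trans (ba_one_le_zloop (ba_finite_graphE _) ht)
      have hn₁ : 0 ≤ Zloop (SimpleGraph.fromEdgeSet (↑Y : Set (Sym2 HexVertex))) Set.univ (Real.tanh β) := zero_le_one.trans (ba_one_le_zloop (ba_finite_graphE _) ht)
      have hn₂ : 0 ≤ Zloop (SimpleGraph.fromEdgeSet (↑(X' ∩ Y) : Set (Sym2 HexVertex))) Set.univ (Real.tanh β) := zero_le_one.trans (ba_one_le_zloop (ba_finite_graphE _) ht)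
      have hn₃ : 0 ≤ Zloop (SimpleGraph.fromEdgeSet (↑(X ∪ Y) : Set (Sym2 HexVertex))) Set.univ (Real.tanh β) := zero_le_one.trans (ba_one_le_zloop (ba_finite_graphE _) ht)
      have key : (Zloop (SimpleGraph.fromEdgeSet (↑X : Set (Sym2 HexVertex))) Set.univ (Real.tanh β) * Zloop (SimpleGraph.fromEdgeSet (↑Y : Set (Sym2 HexVertex))) Set.univ (Real.tanh β)) *
          (Zloop (SimpleGraph.fromEdgeSet (↑X' : Set (Sym2 HexVertex))) Set.univ (Real.tanh β) * Zloop (SimpleGraph.fromEdgeSet (↑(X' ∪ Y) : Set (Sym2 HexVertex))) Set.univ (Real.tanh β)) ≤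
          (Zloop (SimpleGraph.fromEdgeSet (↑(X' ∩ Y) : Set (Sym2 HexVertex))) Set.univ (Real.tanh β) * Zloop (SimpleGraph.fromEdgeSet (↑(X ∪ Y) : Set (Sym2 HexVertex))) Set.univ (Real.tanh β)) *
          (Zloop (SimpleGraph.fromEdgeSet (↑X' : Set (Sym2 HexVertex))) Set.univ (Real.tanh β) * Zloop (SimpleGraph.fromEdgeSet (↑(X' ∪ Y) : Set (Sym2 HexVertex))) Set.univ (Real.tanh β)) := by
        calc (Zloop (SimpleGraph.fromEdgeSet (↑X : Set (Sym2 HexVertex))) Set.univ (Real.tanh β) * Zloop (SimpleGraph.fromEdgeSet (↑Y : Set (Sym2 HexVertex))) Set.univ (Real.tanh β)) *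
            (Zloop (SimpleGraph.fromEdgeSet (↑X' : Set (Sym2 HexVertex))) Set.univ (Real.tanh β) * Zloop (SimpleGraph.fromEdgeSet (↑(X' ∪ Y) : Set (Sym2 HexVertex))) Set.univ (Real.tanh β))
            = (Zloop (SimpleGraph.fromEdgeSet (↑X : Set (Sym2 HexVertex))) Set.univ (Real.tanh β) * Zloop (SimpleGraph.fromEdgeSet (↑(X' ∪ Y) : Set (Sym2 HexVertex))) Set.univ (Real.tanh β)) *
              (Zloop (SimpleGraph.fromEdgeSet (↑X' : Set (Sym2 HexVertex))) Set.univ (Real.tanh β) * Zloop (SimpleGraph.fromEdgeSet (↑Y : Set (Sym2 HexVertex))) Set.univ (Real.tanh β)) := by ring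
          _ ≤ (Zloop (SimpleGraph.fromEdgeSet (↑X' : Set (Sym2 HexVertex))) Set.univ (Real.tanh β) * Zloop (SimpleGraph.fromEdgeSet (↑(X ∪ Y) : Set (Sym2 HexVertex))) Set.univ (Real.tanh β)) *
              (Zloop (SimpleGraph.fromEdgeSet (↑(X' ∩ Y) : Set (Sym2 HexVertex))) Set.univ (Real.tanh β) * Zloop (SimpleGraph.fromEdgeSet (↑(X' ∪ Y) : Set (Sym2 HexVertex))) Set.univ (Real.tanh β)) :=
              mul_le_mul hID hIH (mul_nonneg (zero_le_one.trans hpos₁) hn₁)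
                (mul_nonneg (zero_le_one.trans hpos₁) hn₃)
          _ = (Zloop (SimpleGraph.fromEdgeSet (↑(X' ∩ Y) : Set (Sym2 HexVertex))) Set.univ (Real.tanh β) * Zloop (SimpleGraph.fromEdgeSet (↑(X ∪ Y) : Set (Sym2 HexVertex))) Set.univ (Real.tanh β)) *
              (Zloop (SimpleGraph.fromEdgeSet (↑X' : Set (Sym2 HexVertex))) Set.univ (Real.tanh β) * Zloop (SimpleGraph.fromEdgeSet (↑(X' ∪ Y) : Set (Sym2 HexVertex))) Set.univ (Real.tanh β)) := by ring
      exact le_of_mul_le_mul_right key (mul_pos (by linarith) (by linarith))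

/-! ### From edge sets back to vertex sets -/

/-- The edges of `H ≤ hexGraph` inside `S` are honeycomb edges. -/
theorem ba_edgesInside_sub {H : SimpleGraph HexVertex} (hH : H ≤ hexGraph) (hfin : H.edgeSet.Finite)
    (S : Set HexVertex) : (↑((hfin.toFinset.filter fun e => ∀ w ∈ e, w ∈ S)) : Set (Sym2 HexVertex)) ⊆ hexGraph.edgeSet := fun _ he =>
  SimpleGraph.edgeSet_mono hH (hfin.mem_toFinset.1 (Finset.mem_filter.1 (Finset.mem_coe.1 he)).1)

/-- `Zloop H S t = L(edges of H inside S)`. -/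
theorem zloop_eq_zloopE {H : SimpleGraph HexVertex} (hH : H ≤ hexGraph) (hfin : H.edgeSet.Finite)
    (S : Set HexVertex) (t : ℝ) : Zloop H S t = Zloop (SimpleGraph.fromEdgeSet (↑((hfin.toFinset.filter fun e => ∀ w ∈ e, w ∈ S)) : Set (Sym2 HexVertex))) Set.univ t := by
  unfold Zloop
  have hset : {E : Finset (Sym2 HexVertex) | (∀ e ∈ E, e ∈ H.edgeSet ∧ ∀ v ∈ e, v ∈ S) ∧
        ∀ v : HexVertex, Even (E.filter (fun e => v ∈ e)).card} =
      {E : Finset (Sym2 HexVertex) | (∀ e ∈ E, e ∈ ((SimpleGraph.fromEdgeSet (↑((hfin.toFinset.filter fun e => ∀ w ∈ e, w ∈ S)) : Set (Sym2 HexVertex)))).edgeSet ∧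
        ∀ v ∈ e, v ∈ (Set.univ : Set HexVertex)) ∧ ∀ v : HexVertex, Even (E.filter (fun e => v ∈ e)).card} := by
    ext E
    simp only [Set.mem_setOf_eq, Set.mem_univ, implies_true, and_true]
    rw [ba_edgeSet_graphE (ba_edgesInside_sub hH hfin S)]
    simp only [Finset.coe_filter, Set.mem_setOf_eq, Set.Finite.mem_toFinset]
  rw [hset]

/-- `L` is nondecreasing in the edge set (`t ≥ 0`). -/
theorem zloopE_mono {X Y : Finset (Sym2 HexVertex)} (hXY : X ⊆ Y)
    (hY : (↑Y : Set (Sym2 HexVertex)) ⊆ hexGraph.edgeSet) {t : ℝ} (ht : 0 ≤ t) :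
    Zloop (SimpleGraph.fromEdgeSet (↑X : Set (Sym2 HexVertex))) Set.univ t ≤ Zloop (SimpleGraph.fromEdgeSet (↑Y : Set (Sym2 HexVertex))) Set.univ t := by
  have hX : (↑X : Set (Sym2 HexVertex)) ⊆ hexGraph.edgeSet := fun e he => hY (Finset.coe_subset.2 hXY he)
  unfold Zloop
  rw [alg_finsum_eq_sum (ba_finite_graphE X) Set.univ (fun E => ∀ v : HexVertex, Even (E.filter (fun e => v ∈ e)).card)
      (fun E => t ^ E.card),
    alg_finsum_eq_sum (ba_finite_graphE Y) Set.univ (fun E => ∀ v : HexVertex, Even (E.filter (fun e => v ∈ e)).card)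
      (fun E => t ^ E.card)]
  refine Finset.sum_le_sum_of_subset_of_nonneg (fun E hE => ?_) fun _ _ _ => pow_nonneg ht _
  rw [Set.Finite.mem_toFinset, Set.mem_setOf_eq] at hE ⊢
  refine ⟨fun e he => ⟨?_, (hE.1 e he).2⟩, hE.2⟩
  have h := (hE.1 e he).1
  rw [ba_edgeSet_graphE hX] at h
  rw [ba_edgeSet_graphE hY]
  exact Finset.coe_subset.2 hXY h

/-! ### The theorem -/

/-- **Log-supermodularity of the loop-`O(1)` bath in the vertex set.** For a finite subgraph
`H ≤ hexGraph`, `β ≥ 0`, and any two vertex sets: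
`Zloop H S₁ · Zloop H S₂ ≤ Zloop H (S₁ ∩ S₂) · Zloop H (S₁ ∪ S₂)` at weight `tanh β`. -/
theorem zloop_mul_zloop_le_inter_mul_union {H : SimpleGraph HexVertex} (hH : H ≤ hexGraph)
    (hfin : H.edgeSet.Finite) (S₁ S₂ : Set HexVertex) {β : ℝ} (hβ : 0 ≤ β) :
    Zloop H S₁ (Real.tanh β) * Zloop H S₂ (Real.tanh β) ≤
      Zloop H (S₁ ∩ S₂) (Real.tanh β) * Zloop H (S₁ ∪ S₂) (Real.tanh β) := by
  have ht : 0 ≤ Real.tanh β := by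
    rw [Real.tanh_eq_sinh_div_cosh]
    exact div_nonneg (Real.sinh_nonneg_iff.2 hβ) (Real.cosh_pos β).le
  rw [zloop_eq_zloopE hH hfin S₁, zloop_eq_zloopE hH hfin S₂, zloop_eq_zloopE hH hfin (S₁ ∩ S₂),
    zloop_eq_zloopE hH hfin (S₁ ∪ S₂)]
  set X₁ := (hfin.toFinset.filter fun e => ∀ w ∈ e, w ∈ S₁)
  set X₂ := (hfin.toFinset.filter fun e => ∀ w ∈ e, w ∈ S₂)
  have hX₁ := ba_edgesInside_sub hH hfin S₁
  have hX₂ := ba_edgesInside_sub hH hfin S₂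
  have hinter : (hfin.toFinset.filter fun e => ∀ w ∈ e, w ∈ (S₁ ∩ S₂)) = X₁ ∩ X₂ := by
    ext e
    simp only [X₁, X₂, Finset.mem_filter, Finset.mem_inter, Set.mem_inter_iff]
    constructor
    · rintro ⟨he, h⟩; exact ⟨⟨he, fun w hw => (h w hw).1⟩, ⟨he, fun w hw => (h w hw).2⟩⟩
    · rintro ⟨⟨he, h1⟩, ⟨-, h2⟩⟩; exact ⟨he, fun w hw => ⟨h1 w hw, h2 w hw⟩⟩
  have hunion : X₁ ∪ X₂ ⊆ (hfin.toFinset.filter fun e => ∀ w ∈ e, w ∈ (S₁ ∪ S₂)) := by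
    intro e he
    simp only [X₁, X₂, Finset.mem_filter, Finset.mem_union, Set.mem_union] at he ⊢
    rcases he with ⟨he, h⟩ | ⟨he, h⟩
    · exact ⟨he, fun w hw => Or.inl (h w hw)⟩
    · exact ⟨he, fun w hw => Or.inr (h w hw)⟩
  have hSM := zloopE_superMod hβ _ X₁ X₂ rfl hX₁ hX₂
  rw [hinter]
  have hmono := zloopE_mono hunion (ba_edgesInside_sub hH hfin (S₁ ∪ S₂)) ht
  have hn : 0 ≤ Zloop (SimpleGraph.fromEdgeSet (↑(X₁ ∩ X₂) : Set (Sym2 HexVertex))) Set.univ (Real.tanh β) :=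
    zero_le_one.trans (ba_one_le_zloop (ba_finite_graphE _) ht)
  exact hSM.trans (mul_le_mul_of_nonneg_left hmono hn)

/-- **Bath attraction.** The bath weight `w(A) = Zloop(H, Aᶜ)/Zloop(H, univ)` of the route's tilted
law is log-supermodular in the removed set: for any vertex sets `S₁, S₂` (complements of two pieces of
the walk), `Zloop H S₁ · Zloop H S₂ ≤ Zloop H (S₁ ∩ S₂) · Zloop H univ`, i.e.
`w(A₁ ∪ A₂) ≥ w(A₁) · w(A₂)`: removing two tubes together costs less free energy than removing them
separately — the massive loop bath mediates an ATTRACTION between the pieces of the interface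
(GKS II). -/
theorem zloop_bath_attraction :
    ∀ (H : SimpleGraph Literature.Probability.LatticeModels.HexVertex), H ≤ Literature.Probability.LatticeModels.hexGraph → H.edgeSet.Finite → ∀ (S₁ S₂ : Set Literature.Probability.LatticeModels.HexVertex) (β : ℝ), 0 ≤ β → Summit.CriticalPhenomena.SAWScalingLimit.Theorems.SAWMassiveIsingTilt.Zloop H S₁ (Real.tanh β) * Summit.CriticalPhenomena.SAWScalingLimit.Theorems.SAWMassiveIsingTilt.Zloop H S₂ (Real.tanh β) ≤ Summit.CriticalPhenomena.SAWScalingLimit.Theorems.SAWMassiveIsingTilt.Zloop H (S₁ ∩ S₂) (Real.tanh β) * Summit.CriticalPhenomena.SAWScalingLimit.Theorems.SAWMassiveIsingTilt.Zloop H Set.univ (Real.tanh β) := by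
  intro H hH hfin S₁ S₂ β hβ
  have ht : 0 ≤ Real.tanh β := by
    rw [Real.tanh_eq_sinh_div_cosh]
    exact div_nonneg (Real.sinh_nonneg_iff.2 hβ) (Real.cosh_pos β).le
  refine (zloop_mul_zloop_le_inter_mul_union hH hfin S₁ S₂ hβ).trans ?_
  have hn : 0 ≤ Zloop H (S₁ ∩ S₂) (Real.tanh β) := zero_le_one.trans (ba_one_le_zloop hfin ht)
  refine mul_le_mul_of_nonneg_left ?_ hn
  rw [zloop_eq_zloopE hH hfin (S₁ ∪ S₂), zloop_eq_zloopE hH hfin Set.univ]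
  refine zloopE_mono (fun e he => ?_) (ba_edgesInside_sub hH hfin _) ht
  simp only [Finset.mem_filter, Set.mem_univ, implies_true, and_true] at he ⊢
  exact he.1

end Summit.CriticalPhenomena.SAWScalingLimit.Theorems.MassiveWindowSLE.Birth
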